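import Summits.Ventures.HSemireg.WedgePairGlue

/-!
# Venture HSemireg — glue (2/2): th-6's TransversePairLawAt by the shear automorphism

HONEST FRAMING. Part of the Lean index of the computation cell `pub-hsemireg` (seat p3; Sunday enclosure of the
FORMULA-N kernel assets of seats th-7 / th-6, ENCLOSURE-PLAN-p3.md).  Finite-dimensional exterior algebra over a field ONLY:
no variety, no cohomology theory, no semiregularity map is constructed here; nothing here says that HC / HC_CM / HC_AV holds;
no Literature fact is declared or used.  The geometric DICTIONARY (why these ranks are the `HT`-side box ranks of the cell's
STRUCTURE.md §1 / theory/FORMULA-N.md) lives in theory/FORMULA-N-th7.md PART B §A.3 / §N and is NOT asserted in Lean.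

GLUE, file 2 of 2 (th-7 PointPairGlue.lean v2 Part 4 l.760–979): the TRANSVERSE PAIR.  ORDERED binomial expansion with a scalar
weight (`prod_map_add_smul : Π_{a∈l}(u_a + c•v_a) = Σ_{S ⊆ l} c^{|S|} • Π_{a∈l}(v_a if a ∈ S else u_a)`, `l.Nodup`, any `K`-algebra),
`prod_x_add_smul_y : Π_a (x_a + λ•y_a) = vClass (λ^m)`, `vClass_two`; the SHEAR `x_a ↦ x_a`, `y_a ↦ …` (a linear automorphism of the
generators for `λ ≠ μ`), the induced algebra automorphism `Ψ` (`isoOf`, `CliffordAlgebra.equivOfIsometry`), rank invariance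
`finrank_range_wedgeWith_eq`, `Ψ_shear_vClass_pointPair`; RESULT **`transversePairLawAt (hn : 1 ≤ n) (hk : k ≤ n) (A B lam mu) :
FormulaN.TransversePairLawAt K n k A B lam mu`** and **`FN4_transversePair_clause`** (= conjunct 2 of th-6's `FN4_classLevel`, under the
`1 ≤ n` guard of th-6 v2 — without it the clause is false at `n = k = 0`).  th-7's statements and proofs, unchanged.
-/

open Module Set Set.powersetCard

namespace Summit.Ventures.HSemireg.WedgePairGlue

variable (K : Type*) [Field K] (n : ℕ)

section Expansion

variable {A : Type*} [Ring A] [Algebra K A] {ι : Type*} [DecidableEq ι]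

/-- changing the test set by an element not in the list does not change the ordered product. -/
lemma prod_map_ite_insert (u v : ι → A) {a : ι} {l : List ι} (ha : a ∉ l) (S : Finset ι) :
    (l.map fun b => if b ∈ insert a S then v b else u b).prod =
      (l.map fun b => if b ∈ S then v b else u b).prod := by
  congr 1
  apply List.map_congr_left
  intro b hb
  have hba : b ≠ a := fun h => ha (h ▸ hb)
  simp [Finset.mem_insert, hba]

/-- ORDERED binomial expansion with a scalar weight: `Π_{a ∈ l} (u_a + c • v_a) = Σ_{S ⊆ l} c^{|S|} • Π_{a ∈ l} (v_a if a ∈ S else u_a)`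
(products in the order of the list; no commutativity of `A` is used). -/
lemma prod_map_add_smul (u v : ι → A) (c : K) :
    ∀ l : List ι, l.Nodup →
      (l.map fun a => u a + c • v a).prod =
        ∑ S ∈ l.toFinset.powerset, c ^ S.card • (l.map fun a => if a ∈ S then v a else u a).prod
  | [], _ => by simp
  | (a :: l), hnd => by
      have ha : a ∉ l := (List.nodup_cons.mp hnd).1
      have hl : l.Nodup := (List.nodup_cons.mp hnd).2
      have haT : a ∉ l.toFinset := fun h => ha (List.mem_toFinset.mp h)
      have hdisj : Disjoint l.toFinset.powerset (l.toFinset.powerset.image (insert a)) := by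
        rw [Finset.disjoint_left]
        intro S hS hS'
        obtain ⟨S', -, rfl⟩ := Finset.mem_image.mp hS'
        exact haT (Finset.mem_powerset.mp hS (Finset.mem_insert_self a S'))
      have hinj : Set.InjOn (fun S : Finset ι => insert a S) (l.toFinset.powerset : Set (Finset ι)) := by
        intro S hS S' hS' h
        have haS : a ∉ S := fun h' => haT (Finset.mem_powerset.mp (Finset.mem_coe.mp hS) h')
        have haS' : a ∉ S' := fun h' => haT (Finset.mem_powerset.mp (Finset.mem_coe.mp hS') h')
        have h' : insert a S = insert a S' := h
        rw [← Finset.erase_insert haS, h', Finset.erase_insert haS']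
      rw [List.map_cons, List.prod_cons, prod_map_add_smul u v c l hl, List.toFinset_cons,
        Finset.powerset_insert, Finset.sum_union hdisj, Finset.sum_image hinj, add_mul, Finset.mul_sum,
        Finset.mul_sum]
      congr 1
      · apply Finset.sum_congr rfl
        intro S hS
        have haS : a ∉ S := fun h' => haT (Finset.mem_powerset.mp hS h')
        rw [List.map_cons, List.prod_cons, if_neg haS, mul_smul_comm]
      · apply Finset.sum_congr rfl
        intro S hS
        have haS : a ∉ S := fun h' => haT (Finset.mem_powerset.mp hS h')
        rw [List.map_cons, List.prod_cons, if_pos (Finset.mem_insert_self a S), prod_map_ite_insert u v ha,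
          Finset.card_insert_of_notMem haS, pow_succ, mul_smul_comm, smul_mul_assoc, smul_smul]

end Expansion

/-! ### the exponential class `Π_a (x_a + λ y_a) = vClass (λ^m)` -/

/-- `Π_a (x_a + λ•y_a) = vClass (λ^m)` (ordered binomial expansion). -/
lemma prod_x_add_smul_y (lam : K) :
    ((List.finRange n).map fun a => FormulaN.x K n a + lam • FormulaN.y K n a).prod =
      FormulaN.vClass K n (fun m => lam ^ m) := by
  rw [prod_map_add_smul K (FormulaN.x K n) (FormulaN.y K n) lam (List.finRange n)
    (List.nodup_finRange n), List.toFinset_finRange, Finset.powerset_card_disjiUnion, Finset.sum_disjiUnion, Finset.card_univ, Fintype.card_fin,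
    FormulaN.vClass]
  apply Finset.sum_congr rfl
  intro m _
  rw [FormulaN.elemClass, Finset.smul_sum]
  apply Finset.sum_congr rfl
  intro S hS
  rw [(Finset.mem_powersetCard.mp hS).2]

/-- `vClass` is linear in the coefficient sequence (the two-term case we need). -/
lemma vClass_two (A B : K) (q q' : ℕ → K) :
    FormulaN.vClass K n (fun m => A * q m + B * q' m) =
      A • FormulaN.vClass K n q + B • FormulaN.vClass K n q' := by
  simp only [FormulaN.vClass, Finset.smul_sum, smul_smul, ← Finset.sum_add_distrib, ← add_smul]

/-! ### the shear automorphism -/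

/-- the shear `e_{inl a} ↦ e_{inl a} + λ e_{inr a}`, `e_{inr a} ↦ e_{inl a} + μ e_{inr a}` on coordinates. -/
noncomputable def shear (lam mu : K) (h : lam ≠ mu) : FormulaN.N K n ≃ₗ[K] FormulaN.N K n where
  toFun f := Sum.elim (fun a => f (Sum.inl a) + f (Sum.inr a)) (fun a => lam * f (Sum.inl a) + mu * f (Sum.inr a))
  invFun g := Sum.elim (fun a => (mu * g (Sum.inl a) - g (Sum.inr a)) / (mu - lam))
    (fun a => (g (Sum.inr a) - lam * g (Sum.inl a)) / (mu - lam))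
  map_add' f f' := by
    funext i; rcases i with a | a <;> simp only [Pi.add_apply, Sum.elim_inl, Sum.elim_inr] <;> ring
  map_smul' c f := by
    funext i; rcases i with a | a <;> simp only [Pi.smul_apply, smul_eq_mul, Sum.elim_inl, Sum.elim_inr, RingHom.id_apply] <;> ring
  left_inv f := by
    have hml : mu - lam ≠ 0 := sub_ne_zero.mpr (Ne.symm h)
    funext i; rcases i with a | a <;> simp only [Sum.elim_inl, Sum.elim_inr] <;> field_simp <;> ring
  right_inv g := by
    have hml : mu - lam ≠ 0 := sub_ne_zero.mpr (Ne.symm h)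
    funext i; rcases i with a | a <;> simp only [Sum.elim_inl, Sum.elim_inr] <;> field_simp <;> ring

/-- the shear on generators, coordinatewise. -/
lemma shear_apply (lam mu : K) (h : lam ≠ mu) (f : FormulaN.N K n) :
    shear K n lam mu h f =
      Sum.elim (fun a => f (Sum.inl a) + f (Sum.inr a)) (fun a => lam * f (Sum.inl a) + mu * f (Sum.inr a)) := rfl

/-- the shear sends `e_{inl a}` to `e_{inl a} + λ • e_{inr a}`. -/
lemma shear_single_inl (lam mu : K) (h : lam ≠ mu) (a : Fin n) :
    shear K n lam mu h (Pi.single (Sum.inl a) 1) =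
      Pi.single (Sum.inl a) 1 + lam • Pi.single (Sum.inr a) 1 := by
  rw [shear_apply]
  funext i
  rcases i with b | b
  · rw [Sum.elim_inl, Pi.add_apply, Pi.smul_apply]
    by_cases hab : b = a
    · subst hab; simp
    · simp [hab]
  · rw [Sum.elim_inr, Pi.add_apply, Pi.smul_apply]
    by_cases hab : b = a
    · subst hab; simp
    · simp [hab]

/-- the shear sends `e_{inr a}` to `e_{inl a} + μ • e_{inr a}`. -/
lemma shear_single_inr (lam mu : K) (h : lam ≠ mu) (a : Fin n) :
    shear K n lam mu h (Pi.single (Sum.inr a) 1) =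
      Pi.single (Sum.inl a) 1 + mu • Pi.single (Sum.inr a) 1 := by
  rw [shear_apply]
  funext i
  rcases i with b | b
  · rw [Sum.elim_inl, Pi.add_apply, Pi.smul_apply]
    by_cases hab : b = a
    · subst hab; simp
    · simp [hab]
  · rw [Sum.elim_inr, Pi.add_apply, Pi.smul_apply]
    by_cases hab : b = a
    · subst hab; simp
    · simp [hab]

/-! ### the induced automorphism of `⋀N` and rank invariance -/

/-- a linear automorphism of `N` as an isometry of the zero form. -/
noncomputable def isoOf (e : FormulaN.N K n ≃ₗ[K] FormulaN.N K n) :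
    (0 : QuadraticForm K (FormulaN.N K n)).IsometryEquiv (0 : QuadraticForm K (FormulaN.N K n)) :=
  { e with map_app' := fun m => by simp }

/-- the induced algebra automorphism. -/
noncomputable def Ψ (e : FormulaN.N K n ≃ₗ[K] FormulaN.N K n) :
    FormulaN.HT K n ≃ₐ[K] FormulaN.HT K n :=
  CliffordAlgebra.equivOfIsometry (isoOf K n e)

variable (e : FormulaN.N K n ≃ₗ[K] FormulaN.N K n)

/-- `Ψ e` on generators is `e`. -/
lemma Ψ_ι (m : FormulaN.N K n) : Ψ K n e (ExteriorAlgebra.ι K m) = ExteriorAlgebra.ι K (e m) := by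
  rw [Ψ, CliffordAlgebra.equivOfIsometry_apply]
  show CliffordAlgebra.map _ (CliffordAlgebra.ι _ m) = CliffordAlgebra.ι _ _
  rw [CliffordAlgebra.map_apply_ι]
  rfl

/-- `Ψ e` maps the generators onto the generators. -/
lemma map_Ψ_range_ι :
    Submodule.map (Ψ K n e).toLinearMap (LinearMap.range (ExteriorAlgebra.ι K : FormulaN.N K n →ₗ[K] _)) =
      LinearMap.range (ExteriorAlgebra.ι K : FormulaN.N K n →ₗ[K] _) := by
  rw [← LinearMap.range_comp]
  have h : (Ψ K n e).toLinearMap ∘ₗ (ExteriorAlgebra.ι K : FormulaN.N K n →ₗ[K] _) =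
      (ExteriorAlgebra.ι K : FormulaN.N K n →ₗ[K] _) ∘ₗ e.toLinearMap := by
    refine LinearMap.ext fun m => ?_
    simp only [LinearMap.coe_comp, Function.comp_apply, LinearEquiv.coe_coe]
    exact Ψ_ι K n e m
  rw [h, LinearMap.range_comp_of_range_eq_top _ (LinearEquiv.range e)]

/-- `Ψ e` maps `⋀^k` onto `⋀^k`. -/
lemma map_Ψ_exteriorPower (k : ℕ) :
    Submodule.map (Ψ K n e).toLinearMap (⋀[K]^k (FormulaN.N K n)) = ⋀[K]^k (FormulaN.N K n) := by
  show Submodule.map (Ψ K n e).toAlgHom.toLinearMap (LinearMap.range (ExteriorAlgebra.ι K) ^ k) =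
    LinearMap.range (ExteriorAlgebra.ι K) ^ k
  rw [Submodule.map_pow, show (Ψ K n e).toAlgHom.toLinearMap = (Ψ K n e).toLinearMap from rfl, map_Ψ_range_ι]

/-- rank invariance of `θ ↦ θ ∧ v` on `⋀^k` under the automorphism `Ψ`. -/
lemma finrank_range_wedgeWith_eq (k : ℕ) (q q' : ℕ → K)
    (h : Ψ K n e (FormulaN.vClass K n q) = FormulaN.vClass K n q') :
    Module.finrank K (LinearMap.range (FormulaN.wedgeWith K n k q)) =
      Module.finrank K (LinearMap.range (FormulaN.wedgeWith K n k q')) := by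
  have hsub : Submodule.map (Ψ K n e).toLinearMap (LinearMap.range (FormulaN.wedgeWith K n k q)) =
      LinearMap.range (FormulaN.wedgeWith K n k q') := by
    rw [FormulaN.wedgeWith, FormulaN.wedgeWith, LinearMap.range_comp, LinearMap.range_comp,
      Submodule.range_subtype, ← Submodule.map_comp]
    conv_rhs => rw [← map_Ψ_exteriorPower K n e k, ← Submodule.map_comp]
    congr 1
    refine LinearMap.ext fun x => ?_
    simp only [LinearMap.coe_comp, Function.comp_apply, LinearMap.mulRight_apply, AlgEquiv.toLinearMap_apply,
      map_mul, h]
  have h1 := (LinearEquiv.finrank_map_eq (Ψ K n e).toLinearEquiv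
    (LinearMap.range (FormulaN.wedgeWith K n k q))).symm
  rw [h1, hsub]

/-! ### assembling: the shear carries the point pair to the two-exponential class -/

/-- the shear automorphism carries the point-pair class `vClass (A,0,…,0,B)` to the transverse-pair class `vClass (A λ^m + B μ^m)`. -/
lemma Ψ_shear_vClass_pointPair (hn : 1 ≤ n) (A B lam mu : K) (h : lam ≠ mu) :
    Ψ K n (shear K n lam mu h)
        (FormulaN.vClass K n (fun m => (if m = 0 then A else 0) + (if m = n then B else 0))) =
      FormulaN.vClass K n (fun m => A * lam ^ m + B * mu ^ m) := by
  rw [vClass_pointPair K n hn, map_add, map_smul, map_smul, elemClass_zero, elemClass_top, map_list_prod,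
    map_list_prod, List.map_map, List.map_map, vClass_two, ← prod_x_add_smul_y K n lam,
    ← prod_x_add_smul_y K n mu]
  congr 3
  · apply List.map_congr_left
    intro a _
    show Ψ K n _ (FormulaN.x K n a) = _
    rw [FormulaN.x, Ψ_ι, shear_single_inl, map_add, map_smul]
    rfl
  · apply List.map_congr_left
    intro a _
    show Ψ K n _ (FormulaN.y K n a) = _
    rw [FormulaN.y, Ψ_ι, shear_single_inr, map_add, map_smul]
    rfl

/-- **th-6's `TransversePairLawAt`, PROVED** for every field, every `n ≥ 1`, every `k ≤ n`
(FORMULA-N PART A §2.2 THEOREM T for the K-secant / two-exponential classes `A e^{λΘ} + B e^{μΘ}`). -/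
theorem transversePairLawAt (hn : 1 ≤ n) {k : ℕ} (hk : k ≤ n) (A B lam mu : K) :
    FormulaN.TransversePairLawAt K n k A B lam mu := by
  intro hlm hA hB
  rw [← finrank_range_wedgeWith_eq K n (shear K n lam mu hlm) k _ _ (Ψ_shear_vClass_pointPair K n hn A B lam mu hlm)]
  exact pointPairLawAt K n hk A B hA hB hn

/-- the second conjunct of th-6's `FN4_classLevel`, discharged for `n ≥ 1`. -/
theorem FN4_transversePair_clause :
    ∀ (K : Type) [Field K] [CharZero K] (n k : ℕ) (A B lam mu : K), 1 ≤ n → k ≤ n →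
      FormulaN.TransversePairLawAt K n k A B lam mu :=
  fun K _ _ n _ A B lam mu hn hk => transversePairLawAt K n hn hk A B lam mu

end Summit.Ventures.HSemireg.WedgePairGlue
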